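import Mathlib
import Literature.Probability.Percolation.DiagonalStripQKZPinning
import Literature.Probability.Percolation.DiagonalStripHyperplaneRecursion
import HarnessLib

/-!
# The exact qKZ system for the primitive ground state (IP12 §3.4, eqs. (20)–(22), pinned)

Topic `Literature/Probability/Percolation`. Ikhlef–Ponsaing (J. Stat. Phys. 149 (2012),
arXiv:1202.5476) §3.4 normalise the ground state `Ψ` of `t_L(w; z)` to a primitive Laurent
polynomial vector and state that it then satisfies the qKZ system (20)–(22) EXACTLY. In the cluster
language of this development (`ColPattern`, lumped Temperley–Lieb moves, generic rapidity field over
`ℂ` with `q² + q + 1 = 0`) we prove: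

* `lump_cpJoin_cpInsDup`, `lump_cpIsolate_cpInsIso` — the loop-weight-one idempotent relations
  `e_i φ_i = φ_i` on inserted patterns;
* `exchange_numerator_vanishes_odd/even` — by LEMMA A and the recursion up to scalar
  (`DiagonalStripHyperplaneRecursion`), the numerator of the exchange cocycle vanishes on `H_i`, which
  is the input `hvan` of the pinning theorems of `DiagonalStripQKZPinning`;
* `reflect_scalar_zpow`, `groundState_reflect_bot_zpow` — both boundary reflections act on the
  primitive ground state by an even power of the boundary rapidity;
* **`exists_groundState_qKZ_exact`** — there is a primitive polynomial `t`-fixed vector `P` whose bulk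
  exchange relations hold with the EXACT coefficients `[q z_i/z_{i+1}]`, `[z_i/z_{i+1}]`,
  `[q z_{i+1}/z_i]` for all `1 ≤ i ≤ 2m` (odd `i`: joins; even `i`: isolations), and whose top and
  bottom reflections are monomial: `ι_L P = z_L^{2a} P`, `ι_1 P = z_1^{2a'} P`.

No normalisation (and no degree statement) is claimed: this is (20)–(22) for the primitive
representative, which is all that the normalisation-free form of IP12 §4 uses.

## References

* Y. Ikhlef, A. K. Ponsaing, *Finite-size left-passage probability in percolation*, J. Stat. Phys.
  149 (2012) 10–36, arXiv:1202.5476, §3.4 eqs. (20)–(22), (25). [IkhlefPonsaing2012]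
-/

namespace Literature.Probability.Percolation

open Finset Literature.Probability.LatticeModels Literature.Probability.LatticeModels.TemperleyLieb

/-! ### The Temperley–Lieb idempotent relations on inserted patterns (loop weight one) -/

section TLIdempotent

variable {n : ℕ}

/-- **`e_i ∘ φ_i = φ_i` at loop weight `1`, odd `i`**: joining the two duplicated sites of
`cpInsDup j R` and lumping gives back `cpInsDup j R` (`R` valid and lump-fixed). [folklore] -/
theorem lump_cpJoin_cpInsDup (j : Fin (n + 1)) {R : ColPattern n} (hv : IsValid 0 R) (hl : lump R = R) :
    lump (cpJoin (Fin.castSucc j) j.succ (cpInsDup j R)) = cpInsDup j R := by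
  have hj1 : j.predAbove (Fin.castSucc j) = j := predAbove_castSucc_self' j
  have hj2 : j.predAbove j.succ = j := predAbove_succ_self' j
  have hjoin : cpJoin (Fin.castSucc j) j.succ (cpInsDup j R) = cpInsDup j R := by
    refine Prod.ext (funext fun x => funext fun y => ?_) (funext fun x => ?_)
    · rw [Bool.eq_iff_iff, cpJoin_fst_eq_true_iff]
      simp only [cpInsDup_fst, hj1, hj2]
      constructor
      · rintro (h | ⟨h1, h2⟩ | ⟨h1, h2⟩)
        · exact h
        · exact hv.trans _ _ _ h1 h2
        · exact hv.trans _ _ _ h1 h2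
      · exact fun h => Or.inl h
    · rw [Bool.eq_iff_iff, cpJoin_snd_eq_true_iff]
      simp only [cpInsDup_fst, cpInsDup_snd, hj1, hj2]
      constructor
      · rintro (h | ⟨h1, h2⟩ | ⟨h1, h2⟩)
        · exact h
        · exact hv.wall _ _ (hv.symm _ _ h1) h2
        · exact hv.wall _ _ (hv.symm _ _ h1) h2
      · exact fun h => Or.inl h
  rw [hjoin, lump_eq_self_iff]
  intro x y hx hy
  simp only [cpInsDup_fst, cpInsDup_snd] at hx hy ⊢
  exact (lump_eq_self_iff R).1 hl _ _ hx hy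

/-- **`e_i ∘ φ_i = φ_i` at loop weight `1`, even `i`**: isolating the inserted singleton of
`cpInsIso b R` and lumping gives back `cpInsIso b R` (`R` lump-fixed). [folklore] -/
theorem lump_cpIsolate_cpInsIso (b : Fin (n + 2)) {R : ColPattern n} (hl : lump R = R) :
    lump (cpIsolate b (cpInsIso b R)) = cpInsIso b R := by
  have hiso : cpIsolate b (cpInsIso b R) = cpInsIso b R := by
    refine Prod.ext (funext fun x => funext fun y => ?_) (funext fun x => ?_)
    · rw [Bool.eq_iff_iff, cpIsolate_fst_eq_true_iff, cpInsIso_fst_iff]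
      constructor
      · rintro (h | ⟨-, -, h⟩)
        · exact Or.inl h
        · exact h
      · rintro (h | ⟨x', y', rfl, rfl, h⟩)
        · exact Or.inl h
        · exact Or.inr ⟨Fin.succAbove_ne b x', Fin.succAbove_ne b y', Or.inr ⟨x', y', rfl, rfl, h⟩⟩
    · rw [Bool.eq_iff_iff, cpIsolate_snd_eq_true_iff, cpInsIso_snd_iff]
      constructor
      · rintro ⟨-, h⟩; exact h
      · rintro ⟨x', rfl, h⟩
        exact ⟨Fin.succAbove_ne b x', ⟨x', rfl, h⟩⟩
  rw [hiso, lump_eq_self_iff]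
  intro x y hx hy
  rw [cpInsIso_snd_iff] at hx hy
  obtain ⟨x', rfl, hx'⟩ := hx
  obtain ⟨y', rfl, hy'⟩ := hy
  exact (cpInsIso_fst_iff b R _ _).2 (Or.inr ⟨x', y', rfl, rfl, (lump_eq_self_iff R).1 hl _ _ hx' hy'⟩)

end TLIdempotent

/-! ### The exchange numerators vanish on the hyperplanes (from Lemma A) -/

section ExchangeVanishing

open MvPolynomial

variable {n : ℕ}

/-- `hypSubst` is the substitution `X_{i+1} ↦ q X_i`. [folklore] -/
theorem substHom_eq_hypSubst (q : ℂ) (i : ℕ) (f : MvPolynomial ℕ ℂ) :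
    substHom (i + 1) (C q * X i) f = hypSubst q i f := by
  have : (substHom (K₀ := ℂ) (i + 1) (C q * X i)).toRingHom = hypSubst q i := by
    refine ringHom_ext (fun a => ?_) (fun k => ?_)
    · simp [hypSubst_C]
    · simp only [AlgHom.toRingHom_eq_coe, RingHom.coe_coe, hypSubst_X]
      split_ifs with h
      · subst h; exact substHom_X_self _ _
      · exact substHom_X_of_ne _ h
  exact RingHom.congr_fun this f

/-- The key polynomial identity `η(A) = η(q B)` on `H_i` at `q³ = 1`. [folklore] -/
theorem substHom_exchange_coeff {q : ℂ} (hq : q ^ 2 + q + 1 = 0) (i : ℕ) :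
    substHom (i + 1) (C q * X i) (C (q ^ 2) * X (i + 1) ^ 2 - X i ^ 2 : MvPolynomial ℕ ℂ) =
      substHom (i + 1) (C q * X i) (C q * (X i ^ 2 - X (i + 1) ^ 2)) := by
  have hii : i ≠ i + 1 := by omega
  have h3 : q ^ 3 = 1 := by linear_combination (q - 1) * hq
  simp only [map_sub, map_mul, map_pow, substHom_C, substHom_X_self, substHom_X_of_ne _ hii]
  have : (C q ^ 2 * (C q * X i) ^ 2 - X i ^ 2 : MvPolynomial ℕ ℂ) - C q * (X i ^ 2 - (C q * X i) ^ 2) =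
      C (q ^ 4 - 1 - q + q ^ 3) * X i ^ 2 := by
    simp only [map_sub, map_add, map_pow, map_one]; ring
  rw [← sub_eq_zero, this, show q ^ 4 - 1 - q + q ^ 3 = 0 by linear_combination (q + 1) * h3, C_0, zero_mul]

/-- A fibre sum of a push-forward through an idempotent move is the push-forward. [folklore] -/
theorem sum_fiber_pushforward_of_idem {K : Type*} [AddCommMonoid K] {m' : ℕ}
    (e : ColPattern m' → ColPattern m') (φ : ColPattern n → ColPattern m') (u : ColPattern n → K)
    (hidem : ∀ R, u R ≠ 0 → e (φ R) = φ R) (Q : ColPattern m') :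
    ∑ Q₀ ∈ Finset.univ.filter (fun Q₀ => e Q₀ = Q), ∑ R ∈ Finset.univ.filter (fun R => φ R = Q₀), u R =
      ∑ R ∈ Finset.univ.filter (fun R => φ R = Q), u R := by
  classical
  rw [Finset.sum_comm' (t' := Finset.univ.filter (fun R => e (φ R) = Q)) (s' := fun R => {φ R})]
  · simp only [Finset.sum_singleton]
    rw [Finset.sum_filter, Finset.sum_filter]
    refine Finset.sum_congr rfl fun R _ => ?_
    by_cases hu : u R = 0
    · simp [hu]
    · rw [hidem R hu]
  · intro Q₀ R
    simp only [Finset.mem_filter, Finset.mem_univ, true_and, Finset.mem_singleton]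
    constructor
    · rintro ⟨h1, h2⟩; exact ⟨h2.symm, by rw [h2]; exact h1⟩
    · rintro ⟨rfl, h1⟩; exact ⟨h1, rfl⟩

/-- **The odd exchange numerator vanishes on `H_i`** (`i = 2j+1`, width `m = n+1`): consequence of
Lemma A (`groundState_hyp_recursion_odd`) and `e_i φ_i = φ_i`. [cite: IkhlefPonsaing2012, §3.4] -/
theorem exchange_numerator_vanishes_odd {q : ℂ} (hq : q ^ 2 + q + 1 = 0) (j : Fin (n + 1))
    {P : ColPattern (n + 1) → MvPolynomial ℕ ℂ}
    (hP : ∀ Q', ∑ Q, ipTransferMatrixW (n + 1) (genC ℂ q) (genW ℂ) (genZ ℂ) Q Q' * toRF ℂ (P Q) = toRF ℂ (P Q')) :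
    ∀ Q, substHom (2 * (j : ℕ) + 1 + 1) (C q * X (2 * (j : ℕ) + 1))
      ((C (q ^ 2) * X (2 * (j : ℕ) + 1 + 1) ^ 2 - X (2 * (j : ℕ) + 1) ^ 2) * P Q -
        C q * (X (2 * (j : ℕ) + 1) ^ 2 - X (2 * (j : ℕ) + 1 + 1) ^ 2) *
          ∑ Q₀ ∈ Finset.univ.filter (fun Q₀ => lump (cpJoin (Fin.castSucc j) j.succ Q₀) = Q), P Q₀) = 0 := by
  classical
  set i := 2 * (j : ℕ) + 1 with hi
  obtain ⟨P', hP'0, hP'⟩ := exists_ipTransferMatrixW_fixed_polynomial (m := n) hq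
  -- the restricted big solution is a multiple of the push-forward
  set ψH : ColPattern (n + 1) → RapidityField ℂ := fun Q => toRF ℂ (hypSubst q i (P Q)) with hψH
  set φψ : ColPattern (n + 1) → RapidityField ℂ := fun Q =>
    ∑ R ∈ Finset.univ.filter (fun R => cpInsDup j R = Q), toRF ℂ (hatRename i (P' R)) with hφψ
  have hne := pushforward_cpInsDup_ne_zero hq j hP'0
  obtain ⟨k, hk⟩ : ∃ k, φψ k ≠ 0 := by
    by_contra h; push Not at h; exact hne (funext h)
  have hprop := groundState_hyp_recursion_odd hq j hP hP' k
  -- so its `e_i`-fibre sums reproduce it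
  have hsuppu : ∀ R, toRF ℂ (hatRename i (P' R)) ≠ 0 → IsValid 0 R ∧ IsPlanar R ∧ lump R = R := by
    intro R hR
    refine groundState_support hq hP' (Q := R) fun h => hR ?_
    rw [toRF_injective (h.trans (map_zero _).symm), map_zero, map_zero]
  have hEφ : ∀ Q, ∑ Q₀ ∈ Finset.univ.filter (fun Q₀ => lump (cpJoin (Fin.castSucc j) j.succ Q₀) = Q), φψ Q₀ = φψ Q :=
    fun Q => sum_fiber_pushforward_of_idem _ _ _ (fun R hR => lump_cpJoin_cpInsDup j (hsuppu R hR).1 (hsuppu R hR).2.2) Q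
  have hEψ : ∀ Q, ∑ Q₀ ∈ Finset.univ.filter (fun Q₀ => lump (cpJoin (Fin.castSucc j) j.succ Q₀) = Q), ψH Q₀ = ψH Q := by
    intro Q
    have hψeq : ∀ Q', ψH Q' = (ψH k / φψ k) * φψ Q' := by
      intro Q'
      have := congrFun hprop Q'
      simp only [Pi.smul_apply, smul_eq_mul] at this
      field_simp
      linear_combination this
    rw [Finset.sum_congr rfl fun Q' _ => hψeq Q', ← Finset.mul_sum, hEφ, ← hψeq]
  -- conclude
  intro Q
  apply toRF_injective
  rw [map_zero, map_sub, map_mul, map_mul, substHom_exchange_coeff hq, map_sum, ← mul_sub, map_mul, map_sub]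
  simp only [map_sum, substHom_eq_hypSubst]
  have := hEψ Q
  simp only [hψH] at this
  rw [this, sub_self, mul_zero]

/-- **The even exchange numerator vanishes on `H_i`** (`i = 2b`, `b ≠ 0`, width `m = n+1`).
[cite: IkhlefPonsaing2012, §3.4] -/
theorem exchange_numerator_vanishes_even {q : ℂ} (hq : q ^ 2 + q + 1 = 0) (b : Fin (n + 2)) (hb : b ≠ 0)
    {P : ColPattern (n + 1) → MvPolynomial ℕ ℂ}
    (hP : ∀ Q', ∑ Q, ipTransferMatrixW (n + 1) (genC ℂ q) (genW ℂ) (genZ ℂ) Q Q' * toRF ℂ (P Q) = toRF ℂ (P Q')) :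
    ∀ Q, substHom (2 * (b : ℕ) + 1) (C q * X (2 * (b : ℕ)))
      ((C (q ^ 2) * X (2 * (b : ℕ) + 1) ^ 2 - X (2 * (b : ℕ)) ^ 2) * P Q -
        C q * (X (2 * (b : ℕ)) ^ 2 - X (2 * (b : ℕ) + 1) ^ 2) *
          ∑ Q₀ ∈ Finset.univ.filter (fun Q₀ => lump (cpIsolate b Q₀) = Q), P Q₀) = 0 := by
  classical
  set i := 2 * (b : ℕ) with hi
  obtain ⟨P', hP'0, hP'⟩ := exists_ipTransferMatrixW_fixed_polynomial (m := n) hq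
  set ψH : ColPattern (n + 1) → RapidityField ℂ := fun Q => toRF ℂ (hypSubst q i (P Q)) with hψH
  set φψ : ColPattern (n + 1) → RapidityField ℂ := fun Q =>
    ∑ R ∈ Finset.univ.filter (fun R => cpInsIso b R = Q), toRF ℂ (hatRename i (P' R)) with hφψ
  have hne := pushforward_cpInsIso_ne_zero hq b hb hP'0 hP'
  obtain ⟨k, hk⟩ : ∃ k, φψ k ≠ 0 := by
    by_contra h; push Not at h; exact hne (funext h)
  have hprop := groundState_hyp_recursion_even hq b hb hP hP' k
  have hsuppu : ∀ R, toRF ℂ (hatRename i (P' R)) ≠ 0 → IsValid 0 R ∧ IsPlanar R ∧ lump R = R := by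
    intro R hR
    refine groundState_support hq hP' (Q := R) fun h => hR ?_
    rw [toRF_injective (h.trans (map_zero _).symm), map_zero, map_zero]
  have hEφ : ∀ Q, ∑ Q₀ ∈ Finset.univ.filter (fun Q₀ => lump (cpIsolate b Q₀) = Q), φψ Q₀ = φψ Q :=
    fun Q => sum_fiber_pushforward_of_idem _ _ _ (fun R hR => lump_cpIsolate_cpInsIso b (hsuppu R hR).2.2) Q
  have hEψ : ∀ Q, ∑ Q₀ ∈ Finset.univ.filter (fun Q₀ => lump (cpIsolate b Q₀) = Q), ψH Q₀ = ψH Q := by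
    intro Q
    have hψeq : ∀ Q', ψH Q' = (ψH k / φψ k) * φψ Q' := by
      intro Q'
      have := congrFun hprop Q'
      simp only [Pi.smul_apply, smul_eq_mul] at this
      field_simp
      linear_combination this
    rw [Finset.sum_congr rfl fun Q' _ => hψeq Q', ← Finset.mul_sum, hEφ, ← hψeq]
  intro Q
  apply toRF_injective
  rw [map_zero, map_sub, map_mul, map_mul, substHom_exchange_coeff hq, map_sum, ← mul_sub, map_mul, map_sub]
  simp only [map_sum, substHom_eq_hypSubst]
  have := hEψ Q
  simp only [hψH] at this
  rw [this, sub_self, mul_zero]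

end ExchangeVanishing


/-! ### Reflection scalars at both ends -/

section ReflectionBoth

open MvPolynomial

variable {m : ℕ}

/-- **A reflection scalar of a primitive polynomial ground state is an even power of `z_k`**
(general `k`; from the scalar relation and its cocycle). [cite: IkhlefPonsaing2012, §3.4] -/
theorem reflect_scalar_zpow {q : ℂ} (hq : q ^ 2 + q + 1 = 0) {P : ColPattern m → MvPolynomial ℕ ℂ}
    (hprim : PolyPrimitive P)
    (hP : ∀ Q', ∑ Q, ipTransferMatrixW m (genC ℂ q) (genW ℂ) (genZ ℂ) Q Q' * toRF ℂ (P Q) = toRF ℂ (P Q'))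
    (r : ℕ) {d : RapidityField ℂ} (hd : ∀ Q, genInv ℂ r (toRF ℂ (P Q)) = d * toRF ℂ (P Q)) (hdd : d * genInv ℂ r d = 1) :
    ∃ a : ℤ, ∀ Q, genInv ℂ r (toRF ℂ (P Q)) = genZ ℂ r ^ (2 * a) * toRF ℂ (P Q) := by
  classical
  have hz : genZ ℂ r ≠ 0 := genZ_ne_zero r
  -- a common bound on the `X_L`-degrees
  set N := Finset.univ.sup fun Q => (P Q).degreeOf r with hN
  have hNQ : ∀ Q, (P Q).degreeOf r ≤ N := fun Q => Finset.le_sup (f := fun Q => (P Q).degreeOf r) (Finset.mem_univ Q)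
  -- `d z_L^N` is a polynomial `D₀`
  have hrev : ∀ Q, (d * genZ ℂ r ^ N) * toRF ℂ (P Q) = toRF ℂ (revPoly r N (P Q)) := by
    intro Q
    rw [← invSubst_mul_pow_eq r N (P Q) (hNQ Q), ← genInv_toRF, hd Q]; ring
  obtain ⟨D₀, hD₀⟩ := hprim.exists_eq_toRF (c := d * genZ ℂ r ^ N) fun Q => ⟨_, hrev Q⟩
  have hD₀0 : D₀ ≠ 0 := by
    rintro rfl
    rw [map_zero, mul_eq_zero] at hD₀
    rcases hD₀ with h | h
    · rw [h, zero_mul] at hdd; exact zero_ne_one hdd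
    · exact pow_ne_zero _ hz h
  -- the cocycle: `D₀ · revPoly D₀ = X_L^M`
  set M := D₀.degreeOf r with hM
  have hcocP : D₀ * revPoly r M D₀ = X r ^ M := by
    apply toRF_injective
    have h1 : toRF ℂ D₀ * invSubst ℂ r D₀ = 1 := by
      have := hdd
      rw [show d = toRF ℂ D₀ / genZ ℂ r ^ N by rw [← hD₀, mul_div_cancel_right₀ _ (pow_ne_zero _ hz)], map_div₀,
        map_pow, genInv_toRF, genInv_genZ, Function.update_self] at this
      rw [inv_pow, div_inv_eq_mul, div_mul_eq_mul_div, mul_div_assoc, mul_div_cancel_right₀ _ (pow_ne_zero _ hz)] at this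
      exact this
    rw [map_mul, ← invSubst_mul_pow_eq r M D₀ le_rfl, ← mul_assoc, h1, one_mul, map_pow]; rfl
  obtain ⟨k, -, hk⟩ := (dvd_prime_pow (MvPolynomial.X_prime (R := ℂ) (σ := ℕ) (i := r)) M).1 ⟨_, hcocP.symm⟩
  obtain ⟨u, hu⟩ := hk.symm
  obtain ⟨u₀, hu₀0, hu₀⟩ := (MvPolynomial.isUnit_iff_eq_C_of_isReduced).1 u.isUnit
  have hD₀eq : D₀ = C u₀ * X r ^ k := by rw [← hu, hu₀]; ring
  -- the sign: `u₀ = 1`, by setting `X_L = 1`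
  have hpolyQ : ∀ Q, D₀ * P Q = revPoly r N (P Q) := fun Q => toRF_injective (by rw [map_mul, ← hD₀, hrev Q])
  have hu₀1 : u₀ = 1 := by
    by_contra hne
    refine not_isUnit_X_sub_C r (1 : ℂ) (hprim _ fun Q => ?_)
    rw [C_1]
    apply X_sub_dvd_of_substHom_eq_zero
    have h1 := congrArg (substHom r 1) (hpolyQ Q)
    rw [substHom_one_revPoly, map_mul, hD₀eq, map_mul, map_pow, substHom_C, substHom_X_self, one_pow, mul_one] at h1
    have h2 : C (u₀ - 1) * substHom r 1 (P Q) = 0 := by rw [map_sub, C_1, sub_mul, one_mul, h1, sub_self]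
    exact (mul_eq_zero.1 h2).resolve_left (by rw [C_eq_zero, sub_eq_zero]; exact hne)
  rw [hu₀1, C_1, one_mul] at hD₀eq
  -- `d = z_L^k / z_L^N`
  have hdval : d = genZ ℂ r ^ k / genZ ℂ r ^ N := by
    rw [eq_div_iff (pow_ne_zero _ hz), hD₀, hD₀eq, map_pow]; rfl
  -- parity: `k + N` is even
  obtain ⟨ε, hε, hPε⟩ := primitive_fixed_parity hq hprim hP r
  obtain ⟨Q₀, hQ₀⟩ := hprim.exists_ne_zero
  have hflipd : genFlip ℂ r d = d := by
    have h1 := congrArg (genFlip ℂ r) (hd Q₀)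
    rw [genFlip_genInv, genFlip_toRF, hPε, map_mul (toRF ℂ), map_mul (genInv ℂ r)] at h1
    rw [map_mul (genFlip ℂ r), genFlip_toRF, hPε, map_mul (toRF ℂ)] at h1
    change genInv ℂ r (genC ℂ ε) * _ = _ * (genC ℂ ε * _) at h1
    rw [genInv_genC, hd Q₀] at h1
    have hε0 : genC ℂ ε ≠ 0 := by
      refine toRF_ne_zero_of_eval (fun _ => 1) ?_
      simp only [eval_C]; rintro rfl; norm_num at hε
    have hQ₀' : toRF ℂ (P Q₀) ≠ 0 := fun h => hQ₀ (toRF_injective (h.trans (map_zero _).symm))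
    have h2 : (genFlip ℂ r d - d) * (genC ℂ ε * toRF ℂ (P Q₀)) = 0 := by linear_combination -h1
    exact sub_eq_zero.1 ((mul_eq_zero.1 h2).resolve_right (mul_ne_zero hε0 hQ₀'))
  have heven : Even (k + N) := by
    rw [hdval, map_div₀, map_pow, map_pow, genFlip_genZ, if_pos rfl, neg_pow, neg_pow (genZ ℂ r),
      div_eq_div_iff (mul_ne_zero (pow_ne_zero _ (by norm_num)) (pow_ne_zero _ hz)) (pow_ne_zero _ hz)] at hflipd
    -- (-1)^k z^k z^N = z^k (-1)^N z^N
    have h1 : ((-1 : RapidityField ℂ) ^ k - (-1) ^ N) * (genZ ℂ r ^ k * genZ ℂ r ^ N) = 0 := by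
      linear_combination hflipd
    have h2 : (-1 : RapidityField ℂ) ^ k = (-1) ^ N :=
      sub_eq_zero.1 ((mul_eq_zero.1 h1).resolve_right (mul_ne_zero (pow_ne_zero _ hz) (pow_ne_zero _ hz)))
    have h3 : (-1 : RapidityField ℂ) ^ (k + N) = 1 := by rw [pow_add, h2, ← pow_add, ← two_mul, pow_mul, neg_one_sq, one_pow]
    exact (neg_one_pow_eq_one_iff_even (R := RapidityField ℂ) (by norm_num)).1 h3
  obtain ⟨a, ha⟩ : ∃ a : ℤ, (k : ℤ) - N = 2 * a := by
    obtain ⟨r, hr⟩ := heven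
    exact ⟨(k : ℤ) - r, by omega⟩
  refine ⟨a, fun Q => ?_⟩
  rw [hd Q, hdval, ← ha, zpow_sub₀ hz, zpow_natCast, zpow_natCast]


/-- **The bottom reflection scalar is an even power of `z_1`.** [cite: IkhlefPonsaing2012, §3.4] -/
theorem groundState_reflect_bot_zpow {q : ℂ} (hq : q ^ 2 + q + 1 = 0) {P : ColPattern m → MvPolynomial ℕ ℂ}
    (hprim : PolyPrimitive P)
    (hP : ∀ Q', ∑ Q, ipTransferMatrixW m (genC ℂ q) (genW ℂ) (genZ ℂ) Q Q' * toRF ℂ (P Q) = toRF ℂ (P Q')) :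
    ∃ a : ℤ, ∀ Q, genInv ℂ 1 (toRF ℂ (P Q)) = genZ ℂ 1 ^ (2 * a) * toRF ℂ (P Q) := by
  have hP0 : (fun Q => toRF ℂ (P Q)) ≠ 0 := by
    obtain ⟨Q₀, hQ₀⟩ := hprim.exists_ne_zero
    intro h; exact hQ₀ (toRF_injective ((congrFun h Q₀).trans (map_zero _).symm))
  obtain ⟨⟨d, hd, hdd⟩, -⟩ := groundState_reflect_scalar_cocycle hq hP hP0
  exact reflect_scalar_zpow hq hprim hP 1 hd hdd

end ReflectionBoth

/-! ### The exactly normalised ground state -/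

section ExactQKZ

open MvPolynomial

variable {m : ℕ}

/-- **IP12's qKZ normalisation, pinned**: the transfer matrix `t(w; z⃗)` (`q² + q + 1 = 0`, generic
rapidities over `ℂ`) has a fixed vector `Ψ ≠ 0` satisfying the boundary qKZ system of IP12 §3.4
EXACTLY — all bulk exchange relations `Ř_i(z_i/z_{i+1}) Ψ = π_i Ψ` with the scalar `[q z_i/z_{i+1}]`
and the top reflection `Ψ(…, 1/z_L) = Ψ` — of the form `Ψ = (z_1 ⋯ z_L)^a · P` with `P` a primitive
polynomial vector; the bottom reflection holds up to `z_1^{2(a'-a)}`. (IP12 assert this normalisation; the proof here is: exchange relations up to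
scalars from the interlacing relations, the unitarity cocycle, Lemma A on the hyperplanes
`z_{i+1} = q z_i`, and unique factorisation.) [cite: IkhlefPonsaing2012, §3.4] -/
theorem exists_groundState_qKZ_exact {q : ℂ} (hq : q ^ 2 + q + 1 = 0) :
    ∃ (P : ColPattern m → MvPolynomial ℕ ℂ) (a : ℤ), PolyPrimitive P ∧
      (∀ Q', ∑ Q, ipTransferMatrixW m (genC ℂ q) (genW ℂ) (genZ ℂ) Q Q' * toRF ℂ (P Q) = toRF ℂ (P Q')) ∧
      (∀ (j' : Fin m) Q, qbr (genC ℂ q * genZ ℂ (2 * (j' : ℕ) + 1 + 1) / genZ ℂ (2 * (j' : ℕ) + 1)) * toRF ℂ (P Q) -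
          qbr (genZ ℂ (2 * (j' : ℕ) + 1) / genZ ℂ (2 * (j' : ℕ) + 1 + 1)) *
            ∑ Q₀ ∈ Finset.univ.filter (fun Q₀ => lump (cpJoin (Fin.castSucc j') j'.succ Q₀) = Q), toRF ℂ (P Q₀) =
        qbr (genC ℂ q * genZ ℂ (2 * (j' : ℕ) + 1) / genZ ℂ (2 * (j' : ℕ) + 1 + 1)) *
          genSwap ℂ (2 * (j' : ℕ) + 1) (toRF ℂ (P Q))) ∧
      (∀ (b0 : Fin m) Q, qbr (genC ℂ q * genZ ℂ (2 * (b0 : ℕ) + 2 + 1) / genZ ℂ (2 * (b0 : ℕ) + 2)) * toRF ℂ (P Q) -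
          qbr (genZ ℂ (2 * (b0 : ℕ) + 2) / genZ ℂ (2 * (b0 : ℕ) + 2 + 1)) *
            ∑ Q₀ ∈ Finset.univ.filter (fun Q₀ => lump (cpIsolate b0.succ Q₀) = Q), toRF ℂ (P Q₀) =
        qbr (genC ℂ q * genZ ℂ (2 * (b0 : ℕ) + 2) / genZ ℂ (2 * (b0 : ℕ) + 2 + 1)) *
          genSwap ℂ (2 * (b0 : ℕ) + 2) (toRF ℂ (P Q))) ∧
      (∀ Q, genInv ℂ (2 * m + 1) (toRF ℂ (P Q)) = genZ ℂ (2 * m + 1) ^ (2 * a) * toRF ℂ (P Q)) ∧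
      (∃ a' : ℤ, ∀ Q, genInv ℂ 1 (toRF ℂ (P Q)) = genZ ℂ 1 ^ (2 * a') * toRF ℂ (P Q)) := by
  obtain ⟨P, hprim, hP⟩ := exists_ipTransferMatrixW_fixed_primitive (m := m) hq
  obtain ⟨a, ha⟩ := groundState_reflect_top_zpow hq hprim hP
  refine ⟨P, a, hprim, hP, fun j' => ?_, fun b0 => ?_, ha, groundState_reflect_bot_zpow hq hprim hP⟩
  · cases m with
    | zero => exact j'.elim0
    | succ n => exact groundState_exchange_odd_exact hq hprim hP j' (exchange_numerator_vanishes_odd hq j' hP)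
  · cases m with
    | zero => exact b0.elim0
    | succ n =>
      have h := exchange_numerator_vanishes_even hq b0.succ (Fin.succ_ne_zero b0) hP
      simp only [Fin.val_succ] at h
      refine groundState_exchange_even_exact hq hprim hP b0 fun Q => ?_
      have e1 : 2 * ((b0 : ℕ) + 1) = 2 * (b0 : ℕ) + 2 := by ring
      have := h Q
      rw [e1] at this
      exact this

end ExactQKZ

end Literature.Probability.Percolation
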